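import Literature.Computability.Cryptography.RegevIndependentSamples
import Literature.Computability.Cryptography.IIDStatisticalDistance
import HarnessLib

/-!
# Regev 2009, Lemma 3.17: the `n²` samples at a good radius are short and span (probability bound)

Topic `Computability/Cryptography` (family `pqc`), grouping namespace `Regev2009`. Sequel of
`RegevIndependentSamples.lean` (Cor. 3.16) and `IIDStatisticalDistance.lean` (hybrid bound for iid
products) in the decomposition of the named fact
`Literature.Computability.Cryptography.regev_lwe_to_sivp_quantum` (pqc.S19; Regev, J. ACM 56 (2009),
Thm 1.1), step `GIVP_{2√n φ} ≤ DGS_φ` (**Lemma 3.17**, hypothesis `h₃` of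
`regev_lwe_to_sivp_quantum_of_worstCase`). The printed correctness argument (p. 21): *"By
Corollary 3.16, `Sᵢ` contains `n` linearly independent vectors with probability exponentially close
to `1`. Moreover, by Lemma 2.5, all vectors in `Sᵢ` are of length at most `rᵢ√n ≤ 2√n φ(L)` with
probability exponentially close to `1`."* Here `Sᵢ` is the set of `n²` answers of the `DGS` oracle at
the good radius `r = rᵢ ∈ (φ(L), 2φ(L)]`; in the tree's machine form
(`UniformQCircuitFamily.SamplesDGS`, `RegevDGSReduction.lean`) the oracle's output law is only
within statistical distance `ν(n)` of `D_{L,r}`, which costs `n² ν(n)` by the hybrid bound.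

Everything here is PROVED; theorems only, no named facts:

* `Regev2009.toOuterMeasure_discreteGaussian_norm_gt_le` — one sample: `Pr_{D_{L,r}}[‖x‖ > r√n] ≤
  (1+ε)/(1-ε) · 2⁻ⁿ` for `η_ε(L) ≤ r` (Banaszczyk's Lemma 2.5 in the form of Micciancio–Regev 2007
  Lemma 4.4, the tree theorem `measureReal_discreteGaussian_norm_sub_ge_le`);
* `Regev2009.toReal_toOuterMeasure_iidPMF_goodSamples_compl_le` — **exact samples**: `n²` iid samples
  from `D_{L,r}`, `√2 η_ε(L) ≤ r`, `0 < ε ≤ 1/10`, fail to (span `V` and all have norm `≤ r√n`)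
  with probability `≤ n (9/10)ⁿ + n² (11/9) 2⁻ⁿ`;
* `Regev2009.toReal_toOuterMeasure_iidPMF_goodVectors_compl_le` — **oracle samples**: the same for
  `n²` iid samples from any law `D̂` on `V` within statistical distance `ν` of `D_{L,r}`, with the
  event "all samples lie in `L`, span `V`, and have norm `≤ r√n`", up to the extra `n² ν`.

## References

* O. Regev, *On lattices, learning with errors, random linear codes, and cryptography*, J. ACM 56
  (2009), art. 34 (author's version arXiv:2401.03703), Lemma 2.5, Cor. 3.16, Lemma 3.17 (proof,
  p. 21) [Regev2009].
* D. Micciancio, O. Regev, *Worst-case to average-case reductions based on Gaussian measures*,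
  SIAM J. Comput. 37 (2007), Lemma 4.4 [MicciancioRegev2007].
* O. Goldreich, *Foundations of Cryptography I*, CUP 2001, §3.2.3 (hybrid argument) [Goldreich2001].
-/

noncomputable section

open Module MeasureTheory
open scoped ENNReal InnerProductSpace

namespace Literature.Computability.Cryptography

namespace Regev2009

open LWE Literature.Probability.Distributions Literature.Algebra.EuclideanLattices

variable {V : Type} [NormedAddCommGroup V] [InnerProductSpace ℝ V] [FiniteDimensional ℝ V]
variable (L : Submodule ℤ V) [DiscreteTopology L] [IsZLattice ℝ L]

/-! ### One sample: the tail `‖x‖ > r√n` -/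

/-- **One discrete Gaussian sample is rarely long**: `Pr_{x ∼ D_{L,r}}[‖x‖ > r√n] ≤ (1+ε)/(1-ε) · 2⁻ⁿ`
for `0 < ε < 1`, `0 < r`, `η_ε(L) ≤ r` (Regev 2009, Lemma 2.5 = Banaszczyk 1993 Lemma 1.5(i), in
the probability form of Micciancio–Regev 2007, Lemma 4.4: the tree theorem
`measureReal_discreteGaussian_norm_sub_ge_le`, whose event `r√n ≤ ‖x‖` contains ours).
[cite: Regev2009, Lemma 2.5; MicciancioRegev2007, Lemma 4.4] -/
theorem toOuterMeasure_discreteGaussian_norm_gt_le {ε r : ℝ} (hε : 0 < ε) (hε1 : ε < 1) (hr : 0 < r)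
    (hηr : smoothingParameter L ε ≤ r) :
    (discreteGaussian L r 0).toOuterMeasure {x : L | r * Real.sqrt (finrank ℝ V) < ‖(x : V)‖} ≤
      ENNReal.ofReal ((1 + ε) / (1 - ε) * (2⁻¹ : ℝ) ^ finrank ℝ V) := by
  borelize V
  have h := measureReal_discreteGaussian_norm_sub_ge_le L hε hε1 hr hηr 0
  haveI : IsProbabilityMeasure (discreteGaussian L r 0).toMeasure := PMF.toMeasure.isProbabilityMeasure _
  calc (discreteGaussian L r 0).toOuterMeasure {x : L | r * Real.sqrt (finrank ℝ V) < ‖(x : V)‖}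
      ≤ (discreteGaussian L r 0).toOuterMeasure
          {x : L | r * Real.sqrt (finrank ℝ V) ≤ ‖(x : V) - 0‖} :=
        PMF.toOuterMeasure_mono _ fun x hx => by
          have h1 := hx.1
          simp only [Set.mem_setOf_eq, sub_zero] at h1 ⊢; exact h1.le
    _ = ENNReal.ofReal ((discreteGaussian L r 0).toMeasure.real
          {x : L | r * Real.sqrt (finrank ℝ V) ≤ ‖(x : V) - 0‖}) := by
        rw [measureReal_def, PMF.toMeasure_apply_eq_toOuterMeasure,
          ENNReal.ofReal_toReal (ne_top_of_le_ne_top ENNReal.one_ne_top ?_)]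
        rw [← PMF.toMeasure_apply_eq_toOuterMeasure]
        exact prob_le_one
    _ ≤ ENNReal.ofReal ((1 + ε) / (1 - ε) * (2⁻¹ : ℝ) ^ finrank ℝ V) := ENNReal.ofReal_le_ofReal h

/-! ### Exact samples -/

/-- **The good event for the `N` samples at radius `r`** (proof of Regev 2009, Lemma 3.17): they
span `V` ("`Sᵢ` contains `n` linearly independent vectors") and all have norm `≤ r√n`.
[cite: Regev2009, Lemma 3.17 (proof)] -/
def goodSamples (r : ℝ) {N : ℕ} : Set (Fin N → L) :=
  {S | tupleSpan S = ⊤ ∧ ∀ j, ‖((S j : L) : V)‖ ≤ r * Real.sqrt (finrank ℝ V)}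

/-- **Regev 2009, Lemma 3.17, probability estimate for exact samples.** For a full-rank lattice `L`
in dimension `n`, `0 < ε ≤ 1/10`, `0 < r` with `√2 η_ε(L) ≤ r`: `n²` independent samples from
`D_{L,r}` fail to span `V` with all norms `≤ r√n` with probability at most
`n (9/10)ⁿ + n² · (11/9) · 2⁻ⁿ` (Cor. 3.16 for the span, Lemma 2.5 / MR07 Lemma 4.4 with
`(1+ε)/(1-ε) ≤ 11/9` and a union bound over the `n²` samples for the norms).
[cite: Regev2009, Lemma 3.17 (proof: Corollary 3.16 and Lemma 2.5)] -/
theorem toReal_toOuterMeasure_iidPMF_goodSamples_compl_le {ε r : ℝ} (hε : 0 < ε) (hε10 : ε ≤ 1 / 10)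
    (hr : 0 < r) (hηr : Real.sqrt 2 * smoothingParameter L ε ≤ r) :
    ((iidPMF (discreteGaussian L r 0) (finrank ℝ V * finrank ℝ V)).toOuterMeasure (goodSamples L r)ᶜ).toReal ≤
      finrank ℝ V * (9 / 10 : ℝ) ^ finrank ℝ V +
        (finrank ℝ V * finrank ℝ V : ℕ) * (11 / 9 * (2⁻¹ : ℝ) ^ finrank ℝ V) := by
  set n := finrank ℝ V with hn
  set D := discreteGaussian L r 0 with hD
  set μ := (iidPMF D (n * n)).toOuterMeasure with hμ
  have hε1 : ε < 1 := by linarith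
  have hη0 : 0 ≤ smoothingParameter L ε := smoothingParameter_nonneg _ _
  have hηr' : smoothingParameter L ε ≤ r := by
    have h1 : (1 : ℝ) ≤ Real.sqrt 2 := Real.one_le_sqrt.2 (by norm_num)
    nlinarith
  -- the union bound
  have hsub : (goodSamples L r)ᶜ ⊆ {S : Fin (n * n) → L | tupleSpan S ≠ ⊤} ∪
      ⋃ j : Fin (n * n), {S | r * Real.sqrt n < ‖((S j : L) : V)‖} := by
    intro S hS
    simp only [goodSamples, Set.mem_compl_iff, Set.mem_setOf_eq, not_and_or, not_forall, not_le] at hS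
    rcases hS with h | ⟨j, hj⟩
    · exact Or.inl h
    · exact Or.inr (Set.mem_iUnion.2 ⟨j, hj⟩)
  -- the span (Cor. 3.16)
  have hspan : μ {S : Fin (n * n) → L | tupleSpan S ≠ ⊤} ≤ ENNReal.ofReal (n * (9 / 10 : ℝ) ^ n) := by
    rw [ENNReal.le_ofReal_iff_toReal_le (ne_top_of_le_ne_top ENNReal.one_ne_top ?_) (by positivity)]
    · exact corollary_3_16 L hε hε10 hr hηr
    · exact (PMF.toOuterMeasure_mono _ (Set.subset_univ _)).trans_eq
        ((PMF.toOuterMeasure_apply_eq_one_iff _ _).2 (Set.subset_univ _))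
  -- each coordinate (Lemma 2.5)
  have hcoord : ∀ j : Fin (n * n), μ {S | r * Real.sqrt n < ‖((S j : L) : V)‖} ≤
      ENNReal.ofReal (11 / 9 * (2⁻¹ : ℝ) ^ n) := by
    intro j
    have hlaw : μ {S | r * Real.sqrt n < ‖((S j : L) : V)‖} =
        D.toOuterMeasure {x : L | r * Real.sqrt n < ‖(x : V)‖} := by
      rw [hμ, show {S : Fin (n * n) → L | r * Real.sqrt n < ‖((S j : L) : V)‖} =
          (fun v : Fin (n * n) → L => v j) ⁻¹' {x : L | r * Real.sqrt n < ‖(x : V)‖} from rfl,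
        ← PMF.toOuterMeasure_map_apply, iidPMF_map_eval]
    rw [hlaw]
    refine (toOuterMeasure_discreteGaussian_norm_gt_le L hε hε1 hr hηr').trans (ENNReal.ofReal_le_ofReal ?_)
    refine mul_le_mul_of_nonneg_right ?_ (by positivity)
    rw [div_le_div_iff₀ (by linarith) (by norm_num)]
    linarith
  have hbound : μ (goodSamples L r)ᶜ ≤ ENNReal.ofReal (n * (9 / 10 : ℝ) ^ n) +
      (n * n : ℕ) * ENNReal.ofReal (11 / 9 * (2⁻¹ : ℝ) ^ n) := by
    refine (measure_mono hsub).trans ((measure_union_le _ _).trans (add_le_add hspan ?_))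
    refine (measure_iUnion_fintype_le μ _).trans ?_
    calc ∑ j : Fin (n * n), μ {S | r * Real.sqrt n < ‖((S j : L) : V)‖}
        ≤ ∑ _j : Fin (n * n), ENNReal.ofReal (11 / 9 * (2⁻¹ : ℝ) ^ n) := Finset.sum_le_sum fun j _ => hcoord j
      _ = (n * n : ℕ) * ENNReal.ofReal (11 / 9 * (2⁻¹ : ℝ) ^ n) := by
          rw [Finset.sum_const, Finset.card_univ, Fintype.card_fin, nsmul_eq_mul]
  refine ENNReal.toReal_le_of_le_ofReal (by positivity) (hbound.trans_eq ?_)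
  rw [ENNReal.ofReal_add (by positivity) (by positivity)]
  congr 1
  rw [ENNReal.ofReal_mul (Nat.cast_nonneg _), ENNReal.ofReal_natCast]

/-! ### Oracle samples (statistical distance `ν` from `D_{L,r}`) -/

/-- **The good event for `N` vectors of `V` returned by a `DGS` oracle at radius `r`**: all of them
are lattice vectors, they span `V`, and all have norm `≤ r√n`. [cite: Regev2009, Lemma 3.17 (proof)] -/
def goodVectors (r : ℝ) {N : ℕ} : Set (Fin N → V) :=
  {S | (∀ j, S j ∈ L) ∧ Submodule.span ℝ (Set.range S) = ⊤ ∧ ∀ j, ‖S j‖ ≤ r * Real.sqrt (finrank ℝ V)}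

omit [FiniteDimensional ℝ V] [DiscreteTopology L] [IsZLattice ℝ L] in
/-- Exact samples, read in `V`, are good vectors exactly when they are good samples. [folklore] -/
theorem comp_val_mem_goodVectors_iff (r : ℝ) {N : ℕ} (S : Fin N → L) :
    (Subtype.val ∘ S) ∈ goodVectors L r ↔ S ∈ goodSamples L r := by
  simp only [goodVectors, goodSamples, Set.mem_setOf_eq, Function.comp_apply, SetLike.coe_mem,
    implies_true, true_and]
  rfl

/-- **Regev 2009, Lemma 3.17, probability estimate for the oracle's samples.** For a full-rank
lattice `L` in dimension `n`, `0 < ε ≤ 1/10`, `0 < r` with `√2 η_ε(L) ≤ r`, and any law `D̂` on `V`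
within statistical distance `ν` of `D_{L,r}` (the output law of a `DGS_φ` sampler at an admissible
radius `r > φ(L)`): `n²` independent samples from `D̂` fail to be lattice vectors spanning `V` of
norms `≤ r√n` with probability at most `n (9/10)ⁿ + n² (11/9) 2⁻ⁿ + n² ν` (the exact-sample bound
and the hybrid bound `LWE.abs_toReal_toOuterMeasure_iidPMF_sub_le`).
[cite: Regev2009, Lemma 3.17 (proof), with §2 p. 11 (negligible output error)] -/
theorem toReal_toOuterMeasure_iidPMF_goodVectors_compl_le {ε r ν : ℝ} (hε : 0 < ε) (hε10 : ε ≤ 1 / 10)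
    (hr : 0 < r) (hηr : Real.sqrt 2 * smoothingParameter L ε ≤ r) (Dhat : PMF V)
    (hν : Dhat.tvDist ((discreteGaussian L r 0).map Subtype.val) ≤ ν) :
    ((iidPMF Dhat (finrank ℝ V * finrank ℝ V)).toOuterMeasure (goodVectors L r)ᶜ).toReal ≤
      finrank ℝ V * (9 / 10 : ℝ) ^ finrank ℝ V +
        (finrank ℝ V * finrank ℝ V : ℕ) * (11 / 9 * (2⁻¹ : ℝ) ^ finrank ℝ V) +
        (finrank ℝ V * finrank ℝ V : ℕ) * ν := by
  set n := finrank ℝ V with hn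
  set D := discreteGaussian L r 0 with hD
  -- hybrid step
  have hhyb := abs_toReal_toOuterMeasure_iidPMF_sub_le Dhat (D.map Subtype.val) (n * n) (goodVectors L r)ᶜ
  have hexact : ((iidPMF (D.map Subtype.val) (n * n)).toOuterMeasure (goodVectors L r)ᶜ).toReal ≤
      n * (9 / 10 : ℝ) ^ n + (n * n : ℕ) * (11 / 9 * (2⁻¹ : ℝ) ^ n) := by
    rw [← iidPMF_map D Subtype.val (n * n), PMF.toOuterMeasure_map_apply]
    refine le_trans (ENNReal.toReal_mono ?_ (PMF.toOuterMeasure_mono _ ?_))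
      (toReal_toOuterMeasure_iidPMF_goodSamples_compl_le L hε hε10 hr hηr)
    · exact ne_top_of_le_ne_top ENNReal.one_ne_top
        ((PMF.toOuterMeasure_mono _ (Set.subset_univ _)).trans_eq
          ((PMF.toOuterMeasure_apply_eq_one_iff _ _).2 (Set.subset_univ _)))
    · intro S hS hS'
      exact hS.1 ((comp_val_mem_goodVectors_iff L r S).2 hS')
  have hN : (0 : ℝ) ≤ (n * n : ℕ) := Nat.cast_nonneg _
  have htv : (n * n : ℕ) * Dhat.tvDist (D.map Subtype.val) ≤ (n * n : ℕ) * ν :=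
    mul_le_mul_of_nonneg_left hν hN
  have habs := abs_le.1 hhyb
  linarith [habs.1, habs.2]

end Regev2009

end Literature.Computability.Cryptography

end
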